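import Summits.CriticalPhenomena.SAWScalingLimit.Theorems.SAWTotalPositivityCriticalBubbleBoundJoinReroot
import Summits.CriticalPhenomena.SAWScalingLimit.Theorems.SAWTotalPositivityCriticalBubbleBoundDockingFlip
import Summits.CriticalPhenomena.SAWScalingLimit.Theorems.SAWTotalPositivityCriticalBubbleBoundJoinRotate

/-!
# Injectivity of the tagged join arrow
(crux `SAWTotalPositivity.CriticalBubbleBound`, stmt-CriticalPhenomena-7117; line `docking-census-joining`,
registered stub `joinArrow_injective` of the join-mass programme, wave 3 / S12, lead prover c6)

Two admissible arrows `(χ¹, χ², k)` and `(χ¹', χ²', k')` of the same total length whose joins re-root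
to the same lex-rooted class, whose junction corners re-root to the same site and whose two surgery
case tags agree, are equal (Hammond 2018 = arXiv:1808.09032, Lemma 4.12, with the multiplicity of the
local surgery carried by the two case tags instead of a decoder): in the common re-rooted frame both
un-joining flips split the class polygon into vertex-disjoint polygon pairs with the origin on the
first member, so the pairs coincide (`Docking.polygon_pair_unique`); the corner and the `τ`-tag give
the window, `unmodify` with the known tags recovers `P(χ¹)` up to a translation between two lex-rooted
frames, which vanishes (`eq_of_pedges_eq_trE`), and likewise for the partner after undoing the spacer
translation and the half-turn; `k` is the ordinate of the partner's shift. Also: the elementary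
calculus of translated edge sets `trE` used here and in `…JoinInjection`.
-/

noncomputable section

open Literature.Probability.LatticeModels
open Literature.Probability.RandomPlanarGeometry Literature.Probability.RandomPlanarGeometry.SAW
open scoped BigOperators
open Summit.CriticalPhenomena.SAWScalingLimit.Theorems.CriticalBubbleBound.Negative (e₀)
open Summit.CriticalPhenomena.SAWScalingLimit.Theorems.CriticalBubbleBound.Docking
open Literature.Probability.Percolation (zdShiftIso)

namespace Summit.CriticalPhenomena.SAWScalingLimit.Theorems.CriticalBubbleBound.Join

/-! ## Translations of edge sets -/

/-- Composition of translations. [folklore] -/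
theorem trE_trE (a b : Site 2) (E : Finset (Sym2 (Site 2))) : trE a (trE b E) = trE (b + a) E := by
  rw [trE, trE, trE, Finset.image_image, ← Sym2.map_comp]
  congr 2
  funext p
  simp only [Function.comp_apply, add_assoc]

/-- Translation by `0`. [folklore] -/
theorem trE_zero (E : Finset (Sym2 (Site 2))) : trE 0 E = E := by
  have : (fun p : Site 2 => p + 0) = id := funext fun p => add_zero p
  rw [trE, this, Sym2.map_id, Finset.image_id]

/-- `trE v` undoes `trE (-v)`. [folklore] -/
theorem trE_trE_neg (v : Site 2) (E : Finset (Sym2 (Site 2))) : trE v (trE (-v) E) = E := by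
  rw [trE_trE, neg_add_cancel, trE_zero]

/-- `trE (-v)` undoes `trE v`. [folklore] -/
theorem trE_neg_trE (v : Site 2) (E : Finset (Sym2 (Site 2))) : trE (-v) (trE v E) = E := by
  rw [trE_trE, add_neg_cancel, trE_zero]

/-- Translation of edge sets is injective. [folklore] -/
theorem trE_injective (v : Site 2) : Function.Injective (trE v) := fun E F h => by
  rw [← trE_neg_trE v E, h, trE_neg_trE]

/-- The edge map of a translation is injective. [folklore] -/
theorem sym2Map_add_injective (v : Site 2) : Function.Injective (Sym2.map fun p : Site 2 => p + v) :=
  Sym2.map.injective (add_left_injective v)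

/-- Translation commutes with unions. [folklore] -/
theorem trE_union (v : Site 2) (E F : Finset (Sym2 (Site 2))) : trE v (E ∪ F) = trE v E ∪ trE v F :=
  Finset.image_union _ _

/-- Translation commutes with set differences. [folklore] -/
theorem trE_sdiff (v : Site 2) (E F : Finset (Sym2 (Site 2))) : trE v (E \ F) = trE v E \ trE v F :=
  Finset.image_sdiff _ _ (sym2Map_add_injective v)

/-- Translation commutes with `insert`. [folklore] -/
theorem trE_insert (v : Site 2) (e : Sym2 (Site 2)) (E : Finset (Sym2 (Site 2))) :
    trE v (insert e E) = insert (Sym2.map (fun p : Site 2 => p + v) e) (trE v E) :=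
  Finset.image_insert _ _ _

/-- Translation commutes with `erase`. [folklore] -/
theorem trE_erase (v : Site 2) (E : Finset (Sym2 (Site 2))) (e : Sym2 (Site 2)) :
    trE v (E.erase e) = (trE v E).erase (Sym2.map (fun p : Site 2 => p + v) e) :=
  Finset.image_erase (sym2Map_add_injective v) _ _

/-- The un-joining flip commutes with translations. [folklore] -/
theorem flipH_trE (v : Site 2) (E : Finset (Sym2 (Site 2))) (q : Site 2) :
    flipH (trE v E) (q + v) = trE v (flipH E q) := by
  rw [flipH, flipH, trE_insert, trE_insert, trE_erase, trE_erase]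
  simp only [Sym2.map_mk, add_right_comm _ v]

/-- The vertices of `IsV` of a union. [folklore] -/
theorem isV_union {E F : Finset (Sym2 (Site 2))} {x : Site 2} : IsV (E ∪ F) x ↔ IsV E x ∨ IsV F x := by
  simp only [IsV, Finset.mem_union, or_and_right, exists_or]

/-- The un-joining flip at a join plaquette does not lose vertices. [folklore] -/
theorem isV_flipH_of_isV {E : Finset (Sym2 (Site 2))} {q x : Site 2} (hx : IsV E x) :
    IsV (flipH E q) x := by
  obtain ⟨e, he, hxe⟩ := hx
  by_cases h1 : e = s(q, q + e₀)
  · subst h1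
    rcases Sym2.mem_iff.1 hxe with rfl | rfl
    · exact ⟨_, Finset.mem_insert_self _ _, Sym2.mem_mk_left _ _⟩
    · exact ⟨_, Finset.mem_insert_of_mem (Finset.mem_insert_self _ _), Sym2.mem_mk_left _ _⟩
  by_cases h2 : e = s(q + e₁, q + e₀ + e₁)
  · subst h2
    rcases Sym2.mem_iff.1 hxe with rfl | rfl
    · exact ⟨_, Finset.mem_insert_self _ _, Sym2.mem_mk_right _ _⟩
    · exact ⟨_, Finset.mem_insert_of_mem (Finset.mem_insert_self _ _), Sym2.mem_mk_right _ _⟩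
  exact ⟨e, Finset.mem_insert_of_mem (Finset.mem_insert_of_mem
    (Finset.mem_erase.2 ⟨h2, Finset.mem_erase.2 ⟨h1, he⟩⟩)), hxe⟩

/-- The un-joining flip at a join plaquette does not create vertices. [folklore] -/
theorem isV_of_isV_flipH {E : Finset (Sym2 (Site 2))} {q x : Site 2} (hq : IsJoinPlaq E q)
    (hx : IsV (flipH E q) x) : IsV E x := by
  obtain ⟨e, he, hxe⟩ := hx
  rw [flipH, Finset.mem_insert, Finset.mem_insert] at he
  rcases he with rfl | rfl | he
  · rcases Sym2.mem_iff.1 hxe with rfl | rfl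
    · exact ⟨_, hq.1, Sym2.mem_mk_left _ _⟩
    · exact ⟨_, hq.2.1, Sym2.mem_mk_left _ _⟩
  · rcases Sym2.mem_iff.1 hxe with rfl | rfl
    · exact ⟨_, hq.1, Sym2.mem_mk_right _ _⟩
    · exact ⟨_, hq.2.1, Sym2.mem_mk_right _ _⟩
  · exact ⟨e, (Finset.mem_erase.1 (Finset.mem_erase.1 he).2).2, hxe⟩

/-- Two pairs of vertex-disjoint polygons with the same union whose first members share a VERTEX
coincide. [folklore] -/
theorem pair_eq_of_common_vertex {P₁ P₁' P₂ P₂' : Finset (Sym2 (Site 2))}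
    (h₁ : IsPolygon (zdGraph 2) P₁) (h₂ : IsPolygon (zdGraph 2) P₂)
    (hd₁ : ∀ x, IsV P₁ x → IsV P₁' x → False) (hd₂ : ∀ x, IsV P₂ x → IsV P₂' x → False)
    (hU : P₁ ∪ P₁' = P₂ ∪ P₂') {x : Site 2} (hx₁ : IsV P₁ x) (hx₂ : IsV P₂ x) :
    P₁ = P₂ ∧ P₁' = P₂' := by
  obtain ⟨e, he, hxe⟩ := hx₁
  have : e ∈ P₂ ∪ P₂' := hU ▸ Finset.mem_union_left _ he
  rcases Finset.mem_union.1 this with h | h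
  · exact polygon_pair_unique h₁ h₂ hd₁ hd₂ hU he h
  · exact (hd₂ x hx₂ ⟨e, h, hxe⟩).elim

/-- Translating the anchor translates `pt`. [folklore] -/
theorem pt_add (Y δ : Site 2) (d : ℤ × ℤ) : pt (Y + δ) d = pt Y d + δ := add_right_comm _ _ _

/-- Translating an explicit list of anchored edges. [folklore] -/
theorem trE_map_toFinset (δ Y : Site 2) (l : List ((ℤ × ℤ) × (ℤ × ℤ))) :
    trE δ ((l.map fun p => s(pt Y p.1, pt Y p.2)).toFinset) =
      (l.map fun p => s(pt (Y + δ) p.1, pt (Y + δ) p.2)).toFinset := by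
  ext e
  simp only [mem_trE, List.mem_toFinset, List.mem_map]
  constructor
  · rintro ⟨_, ⟨p, hp, rfl⟩, rfl⟩
    exact ⟨p, hp, by simp only [Sym2.map_mk, pt_add]⟩
  · rintro ⟨p, hp, rfl⟩
    exact ⟨_, ⟨p, hp, rfl⟩, by simp only [Sym2.map_mk, pt_add]⟩

/-- The added path is translation covariant. [folklore] -/
theorem addedE_add (c : JCase) (Y δ : Site 2) : addedE c (Y + δ) = trE δ (addedE c Y) := by
  rw [addedE, addedE, trE_map_toFinset]

/-- The removed edges are translation covariant. [folklore] -/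
theorem removedE_add (c : JCase) (Y δ : Site 2) : removedE c (Y + δ) = trE δ (removedE c Y) := by
  rw [removedE, removedE, trE_map_toFinset]

/-- The explicit inverse of the modification is translation covariant. [folklore] -/
theorem unmodify_trE (c : JCase) (E : Finset (Sym2 (Site 2))) (Y δ : Site 2) :
    unmodify c (trE δ E) (Y + δ) = trE δ (unmodify c E Y) := by
  rw [unmodify, unmodify, addedE_add, removedE_add, trE_union, trE_sdiff]

/-- RIGIDITY OF LEX-ROOTED CLASSES: if the rooted polygon of a lex-rooted `χ'` is a translate of
that of a lex-rooted `χ` (same walk length `n ≥ 2`), the translation is `0` and `χ' = χ`. [folklore] -/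
theorem eq_of_pedges_eq_trE {n : ℕ} (hn : 2 ≤ n) {χ χ' : ℕ → Site 2} (h : χ ∈ lexRooted n)
    (h' : χ' ∈ lexRooted n) {δ : Site 2} (he : pedges n χ' = trE δ (pedges n χ)) :
    δ = 0 ∧ χ' = χ := by
  have hs := lexRooted_subset n h
  have hs' := lexRooted_subset n h'
  have key : pedges n χ' = pedges n (shift δ χ) := by
    rw [he]; exact (pedges_comp (fun p => p + δ) n χ).symm
  have hv : verts n χ' = (verts n χ).image (fun x => x + δ) := by
    rw [verts_eq_of_pedges_eq key]; exact verts_comp (fun x => x + δ) n χ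
  have hz : (0 : Site 2) ∈ verts n χ := by
    rw [← (Zd.mem_sawFun.1 hs).1]; exact apply_mem_verts χ n.zero_le
  have hz' : (0 : Site 2) ∈ verts n χ' := by
    rw [← (Zd.mem_sawFun.1 hs').1]; exact apply_mem_verts χ' n.zero_le
  have hδ₁ : LexPos δ := by
    have hw : (0 : Site 2) + δ ∈ verts n χ' := by rw [hv]; exact Finset.mem_image_of_mem _ hz
    rw [zero_add] at hw
    obtain ⟨i, hi, hiδ⟩ := Finset.mem_image.1 hw
    rw [← hiδ]
    exact (mem_lexRooted.1 h').2 i (Nat.lt_succ_iff.1 (Finset.mem_range.1 hi))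
  have hδ₂ : LexPos (-δ) := by
    rw [hv, Finset.mem_image] at hz'
    obtain ⟨y, hy, hy0⟩ := hz'
    obtain ⟨i, hi, rfl⟩ := Finset.mem_image.1 hy
    rw [← eq_neg_of_add_eq_zero_left hy0]
    exact (mem_lexRooted.1 h).2 i (Nat.lt_succ_iff.1 (Finset.mem_range.1 hi))
  have hδ := eq_zero_of_lexPos_neg hδ₁ hδ₂
  refine ⟨hδ, ?_⟩
  rw [hδ, shift_by_zero] at key
  exact eq_of_pedges_shift_eq hs' hs hn (v := 0) (by rwa [shift_by_zero, shift_by_zero])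

/-- `pedges` of a translate is the translate of `pedges`. [folklore] -/
theorem pedges_shift (n : ℕ) (v : Site 2) (χ : ℕ → Site 2) : pedges n (shift v χ) = trE v (pedges n χ) :=
  pedges_comp (fun p => p + v) n χ

/-! ## The re-rooted frame of a decomposed join -/

/-- THE RE-ROOTED FRAME. Let `J` be an edge set with a join plaquette at `q` whose un-joining
flip is the union of a polygon `A` and an edge set `B`, vertex-disjoint, with all `B`-vertices on
rows `≥ 1` and `e₀` an `A`-vertex, and let `pedges n χ` be the translate of `J` taking the
lowest-then-leftmost vertex `v` of `J` to the origin. Then `A - v` is a polygon, `A - v` and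
`B - v` are vertex-disjoint with union the flip of `pedges n χ` at `q - v`, and the origin is a
vertex of `A - v` (the lex-minimal vertex of `J` lies weakly below `e₀`, hence not on `B`).
[cite: Hammond2015SAPJoining, Definition 4.4] -/
theorem frame_abstract {J A B : Finset (Sym2 (Site 2))} {q : Site 2} {n : ℕ} {χ : ℕ → Site 2}
    (hplaq : IsJoinPlaq J q) (hA : IsPolygon (zdGraph 2) A) (hdis : ∀ x, IsV A x → IsV B x → False)
    (hflip : flipH J q = A ∪ B) (hB1 : ∀ x, IsV B x → 1 ≤ x 1) (he₀ : IsV A e₀)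
    (hχ : pedges n χ = trE (-lexMinV (vxs J)) J) :
    IsPolygon (zdGraph 2) (trE (-lexMinV (vxs J)) A) ∧
    (∀ x, IsV (trE (-lexMinV (vxs J)) A) x → IsV (trE (-lexMinV (vxs J)) B) x → False) ∧
    trE (-lexMinV (vxs J)) A ∪ trE (-lexMinV (vxs J)) B = flipH (pedges n χ) (q - lexMinV (vxs J)) ∧
    IsV (trE (-lexMinV (vxs J)) A) 0 := by
  set v := lexMinV (vxs J) with hv
  refine ⟨isPolygon_trE _ hA, fun x hx hy => hdis (x - -v) (isV_trE_iff.1 hx) (isV_trE_iff.1 hy), ?_, ?_⟩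
  · rw [← trE_union, ← hflip, hχ, sub_eq_add_neg, flipH_trE]
  · have hJe₀ : IsV J e₀ := by
      refine isV_of_isV_flipH hplaq ?_
      rw [hflip]
      exact isV_union.2 (Or.inl he₀)
    have hne : (vxs J).Nonempty := ⟨e₀, mem_vxs.2 hJe₀⟩
    obtain ⟨hvJ, hmin⟩ := lexMinV_spec hne
    have hv1 : v 1 ≤ 0 := by
      rcases hmin e₀ (mem_vxs.2 hJe₀) with h | ⟨h, -⟩
      · rw [e₀_e₁_apply.2.1] at h
        exact h.le
      · rw [e₀_e₁_apply.2.1] at h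
        exact h.le
    have hvA : IsV A v := by
      have h1 : IsV (flipH J q) v := isV_flipH_of_isV (mem_vxs.1 hvJ)
      rw [hflip, isV_union] at h1
      rcases h1 with h | h
      · exact h
      · have := hB1 v h
        omega
    rw [isV_trE_iff, zero_sub, neg_neg]
    exact hvA

/-! ## The stub -/

/-- **Stub `joinArrow_injective` (injectivity of the tagged arrow).** Two admissible arrows
`(χ¹, χ², k)`, `(χ¹', χ²', k')` of the same total length whose joins re-root to the same class,
whose junction corners re-root to the same site and whose two case tags agree are equal: in the
re-rooted frame both un-joining flips decompose `P(χ)` into vertex-disjoint polygon pairs with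
the origin on the first member, so the pairs coincide (`Docking.polygon_pair_unique`); the
junction corner and the `τ`-tag then determine the window, un-modifying with the known tags
recovers `P(χ¹)` up to the translation between the two frames, which vanishes because both are
lex-rooted at the origin; likewise for the partner after undoing the spacer translation and the
rotation, and `k` is the ordinate of the partner's shift. [cite: Hammond2015SAPJoining, Lemma 4.12] -/
theorem joinArrow_injective : ∀ (j m j' m' : ℕ) (χ₁ χ₂ χ₁' χ₂' : ℕ → Site 2) (k k' : ℤ),
    χ₁ ∈ lexRooted j → χ₂ ∈ lexRooted m → 3 ≤ j → 3 ≤ m → k ∈ offsets j m χ₁ χ₂ →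
    χ₁' ∈ lexRooted j' → χ₂' ∈ lexRooted m' → 3 ≤ j' → 3 ≤ m' → k' ∈ offsets j' m' χ₁' χ₂' →
    j + m = j' + m' →
    rerootWalk (joinPoly j m χ₁ χ₂ k) (j + m + 17) = rerootWalk (joinPoly j' m' χ₁' χ₂' k') (j' + m' + 17) →
    rerootSite (joinPoly j m χ₁ χ₂ k) (joinCorner j m χ₁ χ₂ k) = rerootSite (joinPoly j' m' χ₁' χ₂' k') (joinCorner j' m' χ₁' χ₂' k') →
    joinTags j m χ₁ χ₂ k = joinTags j' m' χ₁' χ₂' k' →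
    j = j' ∧ m = m' ∧ χ₁ = χ₁' ∧ χ₂ = χ₂' ∧ k = k' := by
  intro j m j' m' χ₁ χ₂ χ₁' χ₂' k k' h₁ h₂ hj hm hk h₁' h₂' hj' hm' hk' hsum hW hS hT
  obtain ⟨-, -, hplaq, hAP, -, hdis, hflip, hB1, hAe₀, -, hunτ, hunσ⟩ :=
    joinPoly_spec j m χ₁ χ₂ k h₁ h₂ hj hm hk
  obtain ⟨-, -, hplaq', hAP', -, hdis', hflip', hB1', hAe₀', -, hunτ', hunσ'⟩ :=
    joinPoly_spec j' m' χ₁' χ₂' k' h₁' h₂' hj' hm' hk'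
  obtain ⟨-, hpe, -⟩ := joinPoly_reroot j m χ₁ χ₂ k h₁ h₂ hj hm hk
  obtain ⟨-, hpe', -⟩ := joinPoly_reroot j' m' χ₁' χ₂' k' h₁' h₂' hj' hm' hk'
  have hn : j' + m' + 17 = j + m + 17 := by omega
  rw [hn] at hW hpe'
  -- the two re-rooted frames coincide
  obtain ⟨hP₁, hd₁, hU₁, hz₁⟩ := frame_abstract hplaq hAP hdis hflip hB1 hAe₀ hpe
  obtain ⟨hP₂, hd₂, hU₂, hz₂⟩ := frame_abstract hplaq' hAP' hdis' hflip' hB1' hAe₀' hpe'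
  have hS' : joinCorner j m χ₁ χ₂ k - lexMinV (vxs (joinPoly j m χ₁ χ₂ k)) =
      joinCorner j' m' χ₁' χ₂' k' - lexMinV (vxs (joinPoly j' m' χ₁' χ₂' k')) := hS
  rw [← hW, ← hS'] at hU₂
  obtain ⟨hAA, hBB⟩ := pair_eq_of_common_vertex hP₁ hP₂ hd₁ hd₂ (hU₁.trans hU₂.symm) hz₁ hz₂
  -- names
  set v := lexMinV (vxs (joinPoly j m χ₁ χ₂ k)) with hv
  set v' := lexMinV (vxs (joinPoly j' m' χ₁' χ₂' k')) with hv'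
  set Y := joinY j m χ₁ χ₂ k with hY
  set Y' := joinY j' m' χ₁' χ₂' k' with hY'
  set σ := pedges m (shift (sigmaShift j m χ₁ χ₂ k) χ₂) with hσ
  set σ' := pedges m' (shift (sigmaShift j' m' χ₁' χ₂' k') χ₂') with hσ'
  set cτ := caseOf (pedges j χ₁) Y with hcτd
  set cτ' := caseOf (pedges j' χ₁') Y' with hcτd'
  set cσ := caseR σ Y with hcσd
  set cσ' := caseR σ' Y' with hcσd'
  set δ := v' - v with hδ
  have hA' : modify (pedges j' χ₁') Y' = trE δ (modify (pedges j χ₁) Y) := by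
    rw [← trE_trE_neg v' (modify (pedges j' χ₁') Y'), ← hAA, trE_trE, neg_add_eq_sub]
  have hB' : trE ![spacer cτ' cσ', 0] (modifyR σ' Y') = trE δ (trE ![spacer cτ cσ, 0] (modifyR σ Y)) := by
    rw [← trE_trE_neg v' (trE ![spacer cτ' cσ', 0] (modifyR σ' Y')), ← hBB, trE_trE, neg_add_eq_sub]
  -- tags
  have hcτ : cτ' = cτ := (congrArg Prod.fst hT).symm
  have hcσ : cσ' = cσ := (congrArg Prod.snd hT).symm
  -- the junction corner determines the window
  have hq : joinCorner j' m' χ₁' χ₂' k' = joinCorner j m χ₁ χ₂ k + δ := by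
    rw [hδ]
    calc joinCorner j' m' χ₁' χ₂' k' = joinCorner j' m' χ₁' χ₂' k' - v' + v' := (sub_add_cancel _ _).symm
      _ = joinCorner j m χ₁ χ₂ k - v + v' := by rw [← hS']
      _ = joinCorner j m χ₁ χ₂ k + (v' - v) := by abel
  have hYY : Y' = Y + δ := by
    have h1 : joinCorner j m χ₁ χ₂ k = Y + ![outOff cτ, 0] := rfl
    have h2 : joinCorner j' m' χ₁' χ₂' k' = Y' + ![outOff cτ', 0] := rfl
    rw [h1, h2, hcτ, add_right_comm] at hq
    exact add_right_cancel hq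
  -- decode `τ`
  have hτ : pedges j' χ₁' = trE δ (pedges j χ₁) := by
    calc pedges j' χ₁' = unmodify cτ' (modify (pedges j' χ₁') Y') Y' := hunτ'.symm
      _ = trE δ (unmodify cτ (modify (pedges j χ₁) Y) Y) := by rw [hcτ, hA', hYY, unmodify_trE]
      _ = trE δ (pedges j χ₁) := by rw [hunτ]
  have hjj : j = j' := by
    have c1 := (pedges_shift_isPolygon (lexRooted_subset j h₁) (by omega) 0).2
    have c2 := (pedges_shift_isPolygon (lexRooted_subset j' h₁') (by omega) 0).2
    rw [shift_by_zero] at c1 c2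
    rw [hτ, card_trE_eq, c1] at c2
    omega
  subst hjj
  have hmm : m = m' := by omega
  subst hmm
  obtain ⟨hδ0, hχ₁⟩ := eq_of_pedges_eq_trE (by omega) h₁ h₁' hτ
  subst χ₁'
  -- decode `σ`
  have hY0 : Y' = Y := by rw [hYY, hδ0, add_zero]
  have hB0 : trE ![spacer cτ' cσ', 0] (modifyR σ' Y') = trE ![spacer cτ cσ, 0] (modifyR σ Y) := by
    rw [hB', hδ0, trE_zero]
  rw [hcτ, hcσ, hY0] at hB0
  have hmod : modify (rotE Y σ') Y = modify (rotE Y σ) Y := by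
    have h1 : modifyR σ' Y = modifyR σ Y := trE_injective _ hB0
    rw [modifyR, modifyR] at h1
    rw [← rotE_rotE_eq Y (modify (rotE Y σ') Y), h1, rotE_rotE_eq]
  have hrot : rotE Y σ' = rotE Y σ := by
    rw [hcσ, hY0] at hunσ'
    rw [← hunσ', hmod, hunσ]
  have hσσ : σ' = σ := by rw [← rotE_rotE_eq Y σ', hrot, rotE_rotE_eq]
  set u := sigmaShift j m χ₁ χ₂ k with hu
  set u' := sigmaShift j m χ₁ χ₂' k' with hu'
  have h1 : trE u' (pedges m χ₂') = trE u (pedges m χ₂) := by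
    rw [← pedges_shift, ← pedges_shift]
    exact hσσ
  have hσ2 : pedges m χ₂' = trE (u + -u') (pedges m χ₂) := by
    rw [← trE_trE, ← h1, trE_neg_trE]
  obtain ⟨hu0, hχ₂⟩ := eq_of_pedges_eq_trE (by omega) h₂ h₂' hσ2
  have huu : u = u' := by rwa [← sub_eq_add_neg, sub_eq_zero] at hu0
  have hk1 : u 1 = k := by simp [hu, sigmaShift]
  have hk1' : u' 1 = k' := by simp [hu', sigmaShift]
  exact ⟨rfl, rfl, rfl, hχ₂.symm, by rw [← hk1, ← hk1', huu]⟩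

end Summit.CriticalPhenomena.SAWScalingLimit.Theorems.CriticalBubbleBound.Join

end
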